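import Literature.Computability.QuantumComplexity.RevUncompute
import Mathlib.Algebra.Polynomial.Eval.Defs
import HarnessLib

/-!
# The sizes of the reversible tableau and of the garbage-free block as polynomials

Trunk `CryptoQuantFine`; bookkeeping for uniformity proofs and polynomial-time parsers around
the tableau of `RevTableau.lean` (`RevSim.Tn`, `Sn`, `LW`, `PP`, `ancN`, `NN`) and the
garbage-free block of `RevUncompute.lean` (`RevClean.JJ`, `copyN`, `width`): every size is the
value at the input length `n` of an explicit polynomial with natural coefficients
(`RevSim.TnPoly`, …, `RevClean.widthPoly`, with `eval` lemmas), so that string functions may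
compute it in unary by `Plumb.polyFn` (`PlumbingBricks.lean`) or compare lengths against it
(`lenLeFn`). (Arora–Barak 2009, Remark 6.7: the tableau sizes are polynomials in `n`.)

## References

* S. Arora, B. Barak, *Computational Complexity: A Modern Approach*, CUP 2009, §6.1, Remark 6.7.
-/

noncomputable section

namespace Literature.Computability.QuantumComplexity

open Polynomial Complexity Complexity.FinTM2Sim Turing

namespace RevSim

variable (tm : FinTM2) (e : ℕ)

/-- `T(n) = (n+2)^e` as a polynomial. [folklore] -/
def TnPoly : Polynomial ℕ := (X + 2) ^ e

/-- `S(n) = n + d T(n) + 2d` as a polynomial. [folklore] -/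
def SnPoly : Polynomial ℕ := X + C (dd tm) * TnPoly e + C (2 * dd tm)

/-- The layer width `LW(n)` as a polynomial. [folklore] -/
def LWPoly : Polynomial ℕ := C (nC tm) + (SnPoly tm e + C (dd tm)) * C (CW tm)

/-- The period `PP(n)` as a polynomial. [folklore] -/
def PPPoly : Polynomial ℕ := LWPoly tm e + C (RW tm)

/-- The ancilla count `ancN(n)` as a polynomial. [folklore] -/
def ancNPoly : Polynomial ℕ := TnPoly e * PPPoly tm e + LWPoly tm e + 1

variable {tm e}

/-- Value of `TnPoly`. [folklore] -/
@[simp] theorem eval_TnPoly (n : ℕ) : (TnPoly e).eval n = Tn e n := by simp [TnPoly, Tn]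

/-- Value of `SnPoly`. [folklore] -/
@[simp] theorem eval_SnPoly (n : ℕ) : (SnPoly tm e).eval n = Sn tm e n := by simp [SnPoly, Sn]

/-- Value of `LWPoly`. [folklore] -/
@[simp] theorem eval_LWPoly (n : ℕ) : (LWPoly tm e).eval n = LW tm e n := by simp [LWPoly, LW]

/-- Value of `PPPoly`. [folklore] -/
@[simp] theorem eval_PPPoly (n : ℕ) : (PPPoly tm e).eval n = PP tm e n := by simp [PPPoly, PP]

/-- Value of `ancNPoly`. [folklore] -/
@[simp] theorem eval_ancNPoly (n : ℕ) : (ancNPoly tm e).eval n = ancN tm e n := by simp [ancNPoly, ancN]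

end RevSim

namespace RevClean

open RevSim

variable (e : ℕ) (M : TM2ComputableAux Bool Bool)

/-- The tableau bound `NN(n) = n + ancN(n)` as a polynomial. [folklore] -/
def NNPoly : Polynomial ℕ := X + ancNPoly M.tm e

/-- The number of read-out cells `JJ(n)` as a polynomial. [folklore] -/
def JJPoly : Polynomial ℕ := SnPoly M.tm e + C (dd M.tm)

/-- The number of result wires `copyN(n)` as a polynomial. [folklore] -/
def copyNPoly : Polynomial ℕ := JJPoly e M * C (A₁ M)

/-- **The width of the garbage-free block `width(n)` as a polynomial.** [folklore] -/
def widthPoly : Polynomial ℕ := NNPoly e M + copyNPoly e M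

variable {e M}

/-- Value of `NNPoly`. [folklore] -/
@[simp] theorem eval_NNPoly (n : ℕ) : (NNPoly e M).eval n = NN e M n := by simp [NNPoly, NN]

/-- Value of `JJPoly`. [folklore] -/
@[simp] theorem eval_JJPoly (n : ℕ) : (JJPoly e M).eval n = JJ e M n := by simp [JJPoly, JJ]

/-- Value of `copyNPoly`. [folklore] -/
@[simp] theorem eval_copyNPoly (n : ℕ) : (copyNPoly e M).eval n = copyN e M n := by simp [copyNPoly, copyN]

/-- Value of `widthPoly`. [folklore] -/
@[simp] theorem eval_widthPoly (n : ℕ) : (widthPoly e M).eval n = width e M n := by simp [widthPoly, width]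

end RevClean

end Literature.Computability.QuantumComplexity

end
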